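import Mathlib
import Literature.Computability.Complexity.HardCoreLemma
import Literature.Computability.Complexity.ACRealizeOver
import Literature.Computability.Complexity.ThresholdGadgets
import HarnessLib

/-!
# `LiouvilleOrthogonalTC0` (stmt-QuantumAdvantage-1393), line `Sketch`: stub `stub_hardcore`

Impagliazzo's hard-core lemma for the concrete class "computed by a circuit over `tcBasis` of
`acDepth ≤ d` with `≤ s` gates" (the tree predicate `ACRealOver tcBasis g d s`,
`Literature/Computability/Complexity/ACRealizeOver.lean`), in the MEASURE form consumed by the
line's XOR step, PROVED here from the tree's boosting form
`Literature.Computability.Complexity.HardCore.exists_majority_correct`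
(`Literature/Computability/Complexity/HardCoreLemma.lean`) by contraposition:

* universe: the subtype `↥U` of the piece `U : Finset ℕ` (inputs read through their `n` low bits,
  `u ↦ fun i : Fin n => Nat.testBit u i`);
* class: the predictors `u ↦ g (bits u)` with `ACRealOver tcBasis g d (s + 1)` — size `s + 1`, so
  that a test `g` of size `s` AND its free negation `!g` (`ACRealOver.neg`, `¬ ∈ tcBasis`) both lie
  in the class; this turns the two-sided correlation bound `|Σ M σ_g| ≤ γ Σ M` of the conclusion
  into the one-sided advantage hypothesis `Weak` of the boosting form (`measure_transfer`,
  `advOn_not`);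
* if NO `[0,1]`-valued measure of density `δ` on `U` were hard-core, every capped integer measure of
  the boosting form would have a weak predictor in the class, so `T ≤ K²` members of the class
  would have a positive vote margin off fewer than `δ·#U` points of `U`; their MAJORITY is ONE
  more gate `MAJ_T ∈ tcBasis` on top (`acRealOver_gate (GateFn.maj T)`, `maj_realOver`): depth
  `d + 1`, size `≤ K²(s+1) + 1`, and it agrees with `f` wherever the margin is positive
  (`maj_eq_of_margin_pos`, `card_err_le`) — contradicting the constant-error hardness hypothesis.
-/

set_option linter.dupNamespace false -- D-0017: single-problem summit ⇒ `QuantumAdvantage.QuantumAdvantage` by design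

noncomputable section

namespace Summit.QuantumAdvantage.QuantumAdvantage.Theorems.LiouvilleOrthogonalTC0

open Finset
open Literature.Computability.Complexity

/-! ### Majority votes and vote margins -/

/-- The sum of the signs `+1` (for `vⱼ = true`) / `-1` (for `vⱼ = false`) of a tuple of `T`
Booleans is `2·#ones - T`. -/
theorem sum_sign_eq_true {T : ℕ} (v : Fin T → Bool) :
    ∑ j, (if v j = true then (1 : ℤ) else -1) = 2 * (GateFn.numOnes v : ℤ) - T := by
  have h1 : ∀ j, (if v j = true then (1 : ℤ) else -1) =
      2 * (if v j = true then (1 : ℤ) else 0) - 1 := by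
    intro j
    split_ifs <;> norm_num
  simp_rw [h1]
  rw [Finset.sum_sub_distrib, ← Finset.mul_sum, Finset.sum_boole, Finset.sum_const, card_univ,
    Fintype.card_fin, nsmul_eq_mul, mul_one]
  rfl

/-- **The majority of the votes is correct where the vote margin is positive.** If the margin
`Σ_{j<T} σ_{Pⱼ}(x)` (`+1` for `Pⱼ x = f x`, `-1` otherwise) is positive, then the `MAJ_T` gate
applied to the votes `P₀ x, …, P_{T-1} x` outputs `f x`. -/
theorem maj_eq_of_margin_pos {V : Type*} (f : V → Bool) (P : ℕ → V → Bool) (T : ℕ) (x : V)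
    (h : 0 < HardCore.margin f P T x) :
    decide (T ≤ 2 * GateFn.numOnes (fun j : Fin T => P j x)) = f x := by
  have hs : ∑ j : Fin T, (if P j x = true then (1 : ℤ) else -1) =
      2 * (GateFn.numOnes (fun j : Fin T => P j x) : ℤ) - T :=
    sum_sign_eq_true (fun j : Fin T => P j x)
  have hm : HardCore.margin f P T x = ∑ j : Fin T, (if P j x = f x then (1 : ℤ) else -1) := by
    unfold HardCore.margin HardCore.sgn
    exact Finset.sum_range _
  rw [hm] at h
  by_cases hfx : f x = true
  · rw [hfx] at h ⊢
    rw [hs] at h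
    rw [decide_eq_true_iff]
    omega
  · simp only [Bool.not_eq_true] at hfx
    rw [hfx] at h ⊢
    have hneg : ∑ j : Fin T, (if P j x = false then (1 : ℤ) else -1) =
        -∑ j : Fin T, (if P j x = true then (1 : ℤ) else -1) := by
      rw [← Finset.sum_neg_distrib]
      refine Finset.sum_congr rfl fun j _ => ?_
      cases P j x <;> simp
    rw [hneg, hs] at h
    rw [decide_eq_false_iff_not, not_le]
    omega

/-- Negating a predictor flips the sign of its advantage on every measure. -/
theorem advOn_not {V : Type*} [Fintype V] (f : V → Bool) (M : V → ℤ) (Q : V → Bool) :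
    HardCore.advOn f M (fun x => !Q x) = -HardCore.advOn f M Q := by
  unfold HardCore.advOn HardCore.sgn
  rw [← Finset.sum_neg_distrib]
  refine Finset.sum_congr rfl fun x _ => ?_
  beta_reduce
  cases Q x <;> cases f x <;> simp

/-! ### From capped integer measures on `↥U` to `[0,1]`-valued measures on `ℕ` -/

/-- **Measure transfer.** A capped integer measure `M' : ↥U → [0, K] ∩ ℤ` of the boosting form,
divided by `K` and extended by `0` off `U`, is a `[0,1]`-valued measure `M` on `ℕ` with
`Σ_{u ∈ U} M u = mass M' / K`, against which the `f`-correlation of a test `g` (read through the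
`n` low bits) is `advOn f M' (g ∘ bits) / K`. -/
theorem measure_transfer {n : ℕ} (U : Finset ℕ) (f : ℕ → Bool) {K : ℕ} (hK : (0 : ℝ) < K)
    (M' : ↥U → ℤ) (hM' : ∀ x, 0 ≤ M' x ∧ M' x ≤ K) :
    ∃ M : ℕ → ℝ, (∀ u, 0 ≤ M u ∧ M u ≤ 1) ∧ ∑ u ∈ U, M u = (HardCore.mass M' : ℝ) / K ∧
      ∀ g : (Fin n → Bool) → Bool,
        ∑ u ∈ U, M u * (if g (fun i : Fin n => Nat.testBit u i) = f u then (1 : ℝ) else -1) =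
          (HardCore.advOn (fun x : ↥U => f x) M'
            (fun x : ↥U => g (fun i : Fin n => Nat.testBit (x : ℕ) i)) : ℝ) / K := by
  classical
  refine ⟨fun u => if h : u ∈ U then (M' ⟨u, h⟩ : ℝ) / K else 0, fun u => ?_, ?_, fun g => ?_⟩
  · beta_reduce
    by_cases hu : u ∈ U
    · rw [dif_pos hu]
      obtain ⟨h0, h1⟩ := hM' ⟨u, hu⟩
      exact ⟨div_nonneg (by exact_mod_cast h0) hK.le, (div_le_one hK).2 (by exact_mod_cast h1)⟩
    · rw [dif_neg hu]
      exact ⟨le_rfl, zero_le_one⟩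
  · unfold HardCore.mass
    push_cast
    rw [Finset.sum_div, ← Finset.sum_coe_sort U]
    refine Finset.sum_congr rfl fun x _ => ?_
    rw [dif_pos x.2]
  · unfold HardCore.advOn HardCore.sgn
    push_cast
    rw [Finset.sum_div, ← Finset.sum_coe_sort U]
    refine Finset.sum_congr rfl fun x _ => ?_
    rw [dif_pos x.2, div_mul_eq_mul_div]

/-! ### The majority gate on top of realized members of the class -/

/-- **One `MAJ` gate on top.** If `g₀, …, g_{T-1}` are realized over `tcBasis` at depth `d` with
`s + 1` gates each and `T (s+1) + 1 ≤ S`, then `x ↦ MAJ_T (g₀ x, …, g_{T-1} x)` is realized over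
`tcBasis` at depth `d + 1` with `S` gates (`acRealOver_gate` with the gate `MAJ_T ∈ tcBasis`). -/
theorem maj_realOver {n d s T S : ℕ} (gs : Fin T → (Fin n → Bool) → Bool)
    (hgs : ∀ j, ACRealOver tcBasis (gs j) d (s + 1)) (hT : T * (s + 1) + 1 ≤ S) :
    ACRealOver tcBasis (fun x => decide (T ≤ 2 * GateFn.numOnes fun j => gs j x)) (d + 1) S := by
  have h := acRealOver_gate (ι := Fin n) (B := tcBasis) (GateFn.maj T) (maj_mem_tcBasis T)
    (f := gs) (s := fun _ => s + 1) hgs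
  refine h.mono le_rfl ?_
  change ∑ _j : Fin T, (s + 1) + 1 ≤ S
  rw [Finset.sum_const, card_univ, Fintype.card_fin, smul_eq_mul]
  exact hT

/-- **The majority errs only where the margin is nonpositive.** If `P j = g_j ∘ bits` on `↥U` for
`j < T`, then the points `u ∈ U` where `MAJ_T (g₀ (bits u), …)` differs from `f u` inject (by
`u ↦ ⟨u, _⟩`) into the points of `↥U` of nonpositive vote margin. -/
theorem card_err_le {n T : ℕ} (U : Finset ℕ) (f : ℕ → Bool) (P : ℕ → ↥U → Bool)
    (gs : Fin T → (Fin n → Bool) → Bool)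
    (hP : ∀ (j : Fin T) (x : ↥U), P j x = gs j (fun i : Fin n => Nat.testBit (x : ℕ) i)) :
    #(U.filter fun u =>
        decide (T ≤ 2 * GateFn.numOnes fun j => gs j (fun i : Fin n => Nat.testBit u i)) ≠ f u) ≤
      #((univ : Finset ↥U).filter fun x => HardCore.margin (fun x : ↥U => f x) P T x ≤ 0) := by
  calc #(U.filter fun u =>
        decide (T ≤ 2 * GateFn.numOnes fun j => gs j (fun i : Fin n => Nat.testBit u i)) ≠ f u)
      ≤ #(((univ : Finset ↥U).filter fun x =>
            HardCore.margin (fun x : ↥U => f x) P T x ≤ 0).map (Function.Embedding.subtype _)) := by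
        refine card_le_card fun u hu => ?_
        rw [mem_filter] at hu
        obtain ⟨huU, hne⟩ := hu
        rw [mem_map]
        refine ⟨⟨u, huU⟩, ?_, rfl⟩
        rw [mem_filter]
        refine ⟨mem_univ _, ?_⟩
        by_contra hpos
        push Not at hpos
        apply hne
        have key := maj_eq_of_margin_pos (fun x : ↥U => f x) P T ⟨u, huU⟩ hpos
        have hfun : (fun j : Fin T => gs j fun i : Fin n => Nat.testBit u i) =
            fun j : Fin T => P j ⟨u, huU⟩ :=
          funext fun j => (hP j ⟨u, huU⟩).symm
        rw [hfun]
        exact key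
    _ = #((univ : Finset ↥U).filter fun x => HardCore.margin (fun x : ↥U => f x) P T x ≤ 0) :=
        card_map _

/-! ### The stub -/

/-- **Hard-core measure from constant-error hardness** (Impagliazzo's hard-core lemma for the class
`ACRealOver tcBasis · d s`, from the tree's boosting form `HardCore.exists_majority_correct`,
universe `↥U`, class `{g ∘ bits | ACRealOver tcBasis g d (s+1)}`, cap `K`, contraposed). If every
`g` realizable over `tcBasis` at depth `d + 1` with `K²(s+1) + 1` gates — in particular every
`MAJ` of `≤ K²` functions realizable at depth `d` with `s + 1` gates — errs on `≥ δ·#U` points of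
`U` (inputs read through their `n` low bits), then there is a measure `M : ℕ → [0,1]` with
`Σ_{u ∈ U} M u ≥ δ·#U` against which every `g` realizable at depth `d` with `s` gates has
`f`-correlation `|Σ_{u ∈ U} M(u) σ_g(u)| ≤ γ Σ_{u ∈ U} M(u)`. -/
theorem stub_hardcore (n d s K : ℕ) (U : Finset ℕ) (hU : U.Nonempty) (f : ℕ → Bool) (δ γ : ℝ)
    (hδ : 0 < δ) (hγ : 0 < γ) (hK : 2 ≤ K * γ * δ)
    (hhard : ∀ g : (Fin n → Bool) → Bool, ACRealOver tcBasis g (d + 1) (K ^ 2 * (s + 1) + 1) →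
      δ * #U ≤ #(U.filter fun u => g (fun i : Fin n => Nat.testBit u i) ≠ f u)) :
    ∃ M : ℕ → ℝ, (∀ u, 0 ≤ M u ∧ M u ≤ 1) ∧ δ * #U ≤ ∑ u ∈ U, M u ∧
      ∀ g : (Fin n → Bool) → Bool, ACRealOver tcBasis g d s →
        |∑ u ∈ U, M u * (if g (fun i : Fin n => Nat.testBit u i) = f u then (1 : ℝ) else -1)| ≤
          γ * ∑ u ∈ U, M u := by
  by_contra hcon
  push Not at hcon
  -- `K > 0`
  have hKr : (0 : ℝ) < K := by
    by_contra hle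
    push Not at hle
    nlinarith [mul_pos hγ hδ, hK, hle]
  haveI : Nonempty ↥U := hU.to_subtype
  -- (a) on the universe `↥U`, every capped integer measure of density `δ` has a weak predictor in
  -- the class `{g ∘ bits | ACRealOver tcBasis g d (s + 1)}`
  have hyp : ∀ M' : ↥U → ℤ, (∀ x, 0 ≤ M' x ∧ M' x ≤ K) → HardCore.Dense K δ M' →
      ∃ Q, HardCore.Weak γ (fun x : ↥U => f x)
        {Q | ∃ g : (Fin n → Bool) → Bool, ACRealOver tcBasis g d (s + 1) ∧
          ∀ x : ↥U, Q x = g (fun i : Fin n => Nat.testBit (x : ℕ) i)} M' Q := by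
    intro M' hM' hD
    obtain ⟨M, h01, hmass, hadv⟩ := measure_transfer (n := n) U f hKr M' hM'
    have hdense : δ * #U ≤ ∑ u ∈ U, M u := by
      rw [hmass, le_div_iff₀ hKr]
      have hD' := hD
      unfold HardCore.Dense at hD'
      rw [Fintype.card_coe] at hD'
      calc δ * #U * K = δ * K * #U := by ring
        _ ≤ _ := hD'
    obtain ⟨g, hg, hlt⟩ := hcon M h01 hdense
    rw [hadv g, hmass, abs_div, abs_of_pos hKr, mul_div_assoc', div_lt_div_iff_of_pos_right hKr]
      at hlt
    set Q : ↥U → Bool := fun x : ↥U => g (fun i : Fin n => Nat.testBit (x : ℕ) i) with hQ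
    rcases le_or_gt 0 (HardCore.advOn (fun x : ↥U => f x) M' Q : ℝ) with hpos | hneg
    · refine ⟨Q, ⟨g, hg.mono le_rfl (Nat.le_succ s), fun x => rfl⟩, ?_⟩
      rw [abs_of_nonneg hpos] at hlt
      exact hlt.le
    · refine ⟨fun x => !Q x, ⟨fun y => !g y, hg.neg not_mem_tcBasis, fun x => rfl⟩, ?_⟩
      rw [abs_of_neg hneg] at hlt
      rw [advOn_not]
      push_cast
      exact hlt.le
  -- (b) the boosting form: `T ≤ K²` members of the class with positive margin off `< δ·#U` points
  obtain ⟨T, P, hT, hP, hsmall⟩ := HardCore.exists_majority_correct hγ.le hK hyp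
  have hP' : ∀ j : Fin T, ∃ gj : (Fin n → Bool) → Bool, ACRealOver tcBasis gj d (s + 1) ∧
      ∀ x : ↥U, P j x = gj (fun i : Fin n => Nat.testBit (x : ℕ) i) := fun j => hP j j.2
  choose gs hgs hPgs using hP'
  -- (c) their majority is one more `MAJ_T` gate: depth `d + 1`, size `≤ K²(s+1) + 1`
  have hG := maj_realOver (S := K ^ 2 * (s + 1) + 1) gs hgs
    (Nat.succ_le_succ (Nat.mul_le_mul_right _ hT))
  -- (d) it errs only where the margin is nonpositive: fewer than `δ·#U` points, contradiction
  have h1 := hhard _ hG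
  have h2 := card_err_le U f P gs hPgs
  have h3 : (#(U.filter fun u =>
      decide (T ≤ 2 * GateFn.numOnes fun j => gs j (fun i : Fin n => Nat.testBit u i)) ≠ f u) : ℝ)
        < δ * #U := by
    calc (#(U.filter fun u =>
          decide (T ≤ 2 * GateFn.numOnes fun j => gs j (fun i : Fin n => Nat.testBit u i)) ≠ f u) : ℝ)
        ≤ #((univ : Finset ↥U).filter fun x => HardCore.margin (fun x : ↥U => f x) P T x ≤ 0) := by
          exact_mod_cast h2
      _ < δ * Fintype.card ↥U := hsmall
      _ = δ * #U := by rw [Fintype.card_coe]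
  exact absurd h1 (not_le.mpr h3)

end Summit.QuantumAdvantage.QuantumAdvantage.Theorems.LiouvilleOrthogonalTC0

end
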